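import Literature.MathematicalPhysics.QuantumFieldTheory.Balaban1983to89.Node00.CarriersB6K

/-!
# NODE 00 (YM-PLAN Track A) — STAGE 3: the conjuncts of `DagBinding.B6BlockParam` ON THE TOWER BLOCK OF RECORD that the tree gives BY NAME —
# Prop. 2.3 (T8∕p21 torus census along `toKT`), Prop. 2.7 and Cor. 2.8 (r03's hypothesis-free k-level censuses), the REDUCTION of Prop. 2.6 to r03's
# census form on `kGeoG`, and the knit `b6BlockParam_tower_of` displaying the residual inputs (Lemma 2.1-param, Prop. 2.2, Lemma 2.4, Prop. 2.5, Prop. 2.6-census)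

NODE 00 STAGE-3 MODULE (seat `pub-ymgap-node00-def` g27, 2026-08-25; companion of `Node00.CarriersB6K`; design note `HOME/pub-ymgap-node00-def/STAGE3-SCOPING-g27.md`).
THEOREMS ONLY; every estimate is a lit-balaban theorem cited by name (`B6Prop23KLevelTorusCensus.prop23Printed_kLevelTorusP`,
`B6Prop27PrintedKLevelV1.prop27Printed_kLevel`, `B6Cor28HolderUnifKLevelV1.cor28Printed_kLevel`); the transfers are bookkeeping (same lengths
`lenTP_beta_eq`∕`lenG_beta_eq`, same torus distance, same threshold `MTP_eq`; constants wrapped in `|·|` where a zero functional needs a nonnegative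
right-hand side).  HONEST FRAMING: nothing of Bałaban's newly asserted; the residual displayed hypotheses of `b6BlockParam_tower_of` are OPEN in the tree
(dag-p1's targets); one finite T⁴ programme; NOT ℝ⁴ ∕ infinite volume ∕ OS ∕ mass gap ∕ Clay.
-/

noncomputable section

namespace Literature.MathematicalPhysics.QuantumFieldTheory.Balaban1983to89.Node00

open LatticeFieldCalculus
open B6SectAOperatorsV1 (BondIdx BondIdxSpace)
open B6MultiLevelBoxOperator (N0)
open B6MultiLevelTorusOperator (TDomains)
open B6GlobalChartV1 (PV domT blkV1)
open B6Geom246MultiLevelTorus (geomT)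
open B6Ineq2142KLevelV1 (lvl β beta_level)
open B6KLevelCensusIndexV1 (KIdx kGeo kGeoG)
open B6Prop22KLevelTorusCensus (KTIdx)
open B6Prop22KLevelTorusCensusEta (geoTP gpTP nKT)
open B6Prop23KLevelTorusCensus (CinvTP prop23Printed_kLevelTorusP)
open B6Prop27PrintedKLevelV1 (kQinv prop27Printed_kLevel)
open B6Cor28PrintedKLevelV1 (kH)
open B6Cor28HolderUnifKLevelV1 (cor28Printed_kLevel)
open B6Prop26Census2136KLevelV1 (kG)

variable {d ℓ : ℕ} {hd : 1 ≤ d + 1} {hL : Odd (ℓ + 1) ∧ 1 < ℓ + 1} {b₀ b₁ : ℝ}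

/-! ## §5. Conjuncts BY NAME: Prop. 2.7 (verbatim through `kGeoU`) -/

variable (d ℓ hd hL) in
/-- **Prop. 2.7 (2.149) on the tower block of record** — r03's `prop27Printed_kLevel` restricted to `KRIdx` and read through `kGeoU` (same sites, lengths,
distances, threshold). [cite: Balaban1984PropagatorsII, Prop. 2.7 (2.149) p.249 (kernel version of the lit-balaban r03 lineage)] -/
theorem prop27_tower (hb₀ : 0 < b₀) (hb₁ : b₀ ≤ b₁) :
    B6.Prop27Printed (d + 1) (fun i : KRIdx d ℓ hd hL b₀ b₁ => kGeoU i.1) (fun i => QinvU i.1) := by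
  obtain ⟨M₁, δ₄, C, hM₁, hδ₄, hC, h⟩ := prop27Printed_kLevel (d := d) (ℓ := ℓ) (hd := hd) (hL := hL) hb₀ hb₁
  exact ⟨M₁, δ₄, C, hM₁, hδ₄, hC, fun i _ hM b b' => h i.1 trivial hM b b'⟩

/-! ## §6. Conjuncts BY NAME: Prop. 2.3 (T8∕p21's torus census, re-indexed along `toKT` and read at the carrier blocks) -/

/-- on the index of record the two length conventions agree: `(L^jη)(β c)` in print's units `η = L^{−k}` IS `(L^{j(c)}η)(c)` with `η = |c_f|⁻¹`.
[cite: Balaban1984PropagatorsII, (2.1) p.224, bookkeeping] -/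
theorem lenTP_beta_eq (i : KRIdx d ℓ hd hL b₀ b₁) (c : (kGeoU i.1).Site) :
    (geoTP (toKT i.1)).len (β i.1.hN i.1.D i.1.hk c) = (kGeoU i.1).len c := by
  rw [B6Prop22KLevelTorusCensusEta.geoTP_len, lenU_eq, B6KLevelCensusIndexV1.len_eq,
    beta_level i.1.hN i.1.D i.1.hk (le_trans one_le_two i.1.hk2), i.2, abs_of_pos (by positivity)]
  show ((ℓ : ℝ) + 1) ^ _ * ((((ℓ + 1) ^ i.1.k : ℕ) : ℝ))⁻¹ = _
  push_cast
  rw [div_eq_mul_inv]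

/-- the two thresholds agree: `M = L·M_h` in both conventions. [cite: Balaban1984PropagatorsII, (2.2) p.224, bookkeeping] -/
theorem MTP_eq (i : KIdx d ℓ hd hL b₀ b₁) : (geoTP (toKT i)).M = (kGeoU i).M := by
  show ((ℓ : ℝ) + 1) * (i.Mh : ℝ) = (((ℓ + 1 : ℕ) : ℝ)) * (i.Mh : ℝ)
  push_cast
  ring

variable (d ℓ hd hL b₀ b₁) in
/-- **Prop. 2.3 (2.86)–(2.87) on the tower block of record** — T8∕p21's `prop23Printed_kLevelTorusP` (every nested torus family, print's units) along the
projection `toKT`, read at the carrier blocks of the two bonds (same lengths by `lenTP_beta_eq`, same torus distance, same threshold).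
[cite: Balaban1984PropagatorsII, Prop. 2.3 (2.86)–(2.87) p.238 (kernel version of the lit-balaban torus lineage)] -/
theorem prop23_tower (hℓ : 1 ≤ ℓ) :
    B6.Prop23Printed (d + 1) (fun i : KRIdx d ℓ hd hL b₀ b₁ => kGeoU i.1) (fun i => CinvU i.1) := by
  obtain ⟨M₁, δ₁, C, hM₁, hδ₁, hC, h⟩ := prop23Printed_kLevelTorusP d ℓ hℓ
  refine ⟨M₁, δ₁, C, hM₁, hδ₁, hC, fun i _ hM b b' => ?_⟩
  have hM' : M₁ ≤ (geoTP (toKT i.1)).M := by rw [MTP_eq]; exact hM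
  have h' := h (toKT i.1) trivial hM' (β i.1.hN i.1.D i.1.hk b) (β i.1.hN i.1.D i.1.hk b')
  rw [lenTP_beta_eq, lenTP_beta_eq] at h'
  exact h'

/-! ## §7. Conjuncts BY NAME: Cor. 2.8 (r03's census; the site-cut-off summand carries the zero functional) -/

/-- `‖ζ‖_α + |ζ| ≥ 0` for a torus-site cut-off (print's units). [cite: Balaban1984PropagatorsII, (2.67) p.234, bookkeeping] -/
theorem cutH_site_nonneg (i : KIdx d ℓ hd hL b₀ b₁) (α : ℝ) (z : ↥((toKT i).XB) → ℝ) : 0 ≤ (geoTP (toKT i)).cutH α z :=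
  add_nonneg (B6Prop22KLevelTorusCensusEta.hqTP_nonneg (toKT i) α z) (Real.iSup_nonneg fun _ => abs_nonneg _)

/-- `‖ζ‖^ξ_α + |ζ| ≥ 0` for a fine-bond cut-off. [cite: Balaban1984PropagatorsII, (2.151) p.249, bookkeeping] -/
theorem cutH_bond_nonneg (i : KIdx d ℓ hd hL b₀ b₁) (α : ℝ) (z : PBond (PV d ℓ i.m i.K hd hL) 0 → ℝ) : 0 ≤ (kGeo i).cutH α z :=
  B6Prop26PrintedKLevelV1.cutH_nonneg i α z

variable (d ℓ hd hL) in
/-- **Cor. 2.8 (2.150)–(2.151) on the tower block of record** — r03's `cor28Printed_kLevel` (hypothesis-free) restricted to `KRIdx` and read through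
`kGeoU`: the entries verbatim; the Hölder clause verbatim on fine-bond cut-offs (constant `|C(α)|`) and trivially on site cut-offs (zero functional,
nonnegative right-hand side). [cite: Balaban1984PropagatorsII, Cor. 2.8 (2.150)–(2.151) p.249 (kernel version of the lit-balaban r03 lineage)] -/
theorem cor28_tower (hb₀ : 0 < b₀) (hb₁ : b₀ ≤ b₁) :
    B6.Cor28Printed (d + 1) (fun i : KRIdx d ℓ hd hL b₀ b₁ => kGeoU i.1) (fun i => HU i.1) := by
  obtain ⟨M₁, δ₅, C, Cα, hM₁, hδ₅, hC, h⟩ := cor28Printed_kLevel (d := d) (ℓ := ℓ) (hd := hd) (hL := hL) hb₀ hb₁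
  refine ⟨M₁, δ₅, C, fun α => |Cα α|, hM₁, hδ₅, hC, fun i _ hM => ?_⟩
  obtain ⟨h1, h2⟩ := h i.1 trivial hM
  refine ⟨fun n y c => h1 n y c, fun α ζ y c hα0 hα1 hζ => ?_⟩
  have hy : 0 < (kGeoU i.1).len y := B6KLevelCensusIndexV1.len_pos i.1 y
  have hc : 0 < (kGeoU i.1).len c := B6KLevelCensusIndexV1.len_pos i.1 c
  cases ζ with
  | inl z =>
    show (0 : ℝ) ≤ |Cα α| * (kGeoU i.1).len y ^ (-(1 + α)) * (geoTP (toKT i.1)).cutH α z *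
      (kGeoU i.1).len c ^ (-((d + 1 : ℕ) : ℝ)) * Real.exp (-(δ₅ * (kGeoU i.1).dist y c))
    have := cutH_site_nonneg i.1 α z
    have := Real.rpow_pos_of_pos hy (-(1 + α))
    have := Real.rpow_pos_of_pos hc (-((d + 1 : ℕ) : ℝ))
    positivity
  | inr z =>
    have h' := h2 α z y c hα0 hα1 hζ
    have hX : 0 ≤ (kGeoU i.1).len y ^ (-(1 + α)) * (kGeo i.1).cutH α z *
        (kGeoU i.1).len c ^ (-((d + 1 : ℕ) : ℝ)) * Real.exp (-(δ₅ * (kGeoU i.1).dist y c)) := by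
      have := cutH_bond_nonneg i.1 α z
      have := Real.rpow_pos_of_pos hy (-(1 + α))
      have := Real.rpow_pos_of_pos hc (-((d + 1 : ℕ) : ℝ))
      positivity
    calc (HU i.1).h α (Sum.inr z) c = (kH i.1).h α z c := rfl
      _ ≤ Cα α * (kGeo i.1).len y ^ (-(1 + α)) * (kGeo i.1).cutH α z *
          (kGeo i.1).len c ^ (-((d + 1 : ℕ) : ℝ)) * Real.exp (-(δ₅ * (kGeo i.1).dist y c)) := h'
      _ = Cα α * ((kGeoU i.1).len y ^ (-(1 + α)) * (kGeo i.1).cutH α z *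
          (kGeoU i.1).len c ^ (-((d + 1 : ℕ) : ℝ)) * Real.exp (-(δ₅ * (kGeoU i.1).dist y c))) := by
        simp only [lenU_eq]; ring
      _ ≤ |Cα α| * ((kGeoU i.1).len y ^ (-(1 + α)) * (kGeo i.1).cutH α z *
          (kGeoU i.1).len c ^ (-((d + 1 : ℕ) : ℝ)) * Real.exp (-(δ₅ * (kGeoU i.1).dist y c))) :=
        mul_le_mul_of_nonneg_right (le_abs_self _) hX
      _ = |Cα α| * (kGeoU i.1).len y ^ (-(1 + α)) * (kGeoU i.1).cutH α (Sum.inr z) *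
          (kGeoU i.1).len c ^ (-((d + 1 : ℕ) : ℝ)) * Real.exp (-(δ₅ * (kGeoU i.1).dist y c)) := by
        show _ = |Cα α| * (kGeoU i.1).len y ^ (-(1 + α)) * (kGeo i.1).cutH α z * _ * _
        ring

/-! ## §8. Prop. 2.6: the knit REDUCES it to r03's census form on `kGeoG` (blocks → bonds through `β`; zero functionals on the site summands) -/

/-- `(L^jη)(β b) = (L^{j(b)}η)(b)` (every index, both in `η = |c_f|⁻¹`). [cite: Balaban1984PropagatorsII, (2.1) p.224, (2.45) p.231, bookkeeping] -/
theorem lenG_beta_eq (i : KIdx d ℓ hd hL b₀ b₁) (b : (kGeoU i).Site) :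
    (kGeoG i).len (β i.hN i.D i.hk b) = (kGeoU i).len b := by
  rw [B6KLevelCensusIndexV1.lenG_eq, lenU_eq, B6KLevelCensusIndexV1.len_eq, beta_level i.hN i.D i.hk (le_trans one_le_two i.hk2)]

/-- `|λ| ≥ 0` on both summands. [cite: Balaban1984PropagatorsII, p.231 («|λ| = sup|λ(x)|»), bookkeeping] -/
theorem supNormU_nonneg (i : KIdx d ℓ hd hL b₀ b₁) (lam : (kGeoU i).Loc) : 0 ≤ (kGeoU i).supNorm lam := by
  cases lam with
  | inl f => exact Real.iSup_nonneg fun _ => abs_nonneg _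
  | inr J => exact B6KLevelCensusIndexV1.supNormG_nonneg i J

/-- `‖λ‖_ε ≥ 0` on both summands. [cite: Balaban1984PropagatorsII, (2.138) p.247, bookkeeping] -/
theorem holderU_nonneg (i : KIdx d ℓ hd hL b₀ b₁) (ε : ℝ) (lam : (kGeoU i).Loc) : 0 ≤ (kGeoU i).holder ε lam := by
  cases lam with
  | inl f => exact B6Prop22KLevelTorusCensusEta.hqTP_nonneg (toKT i) ε f
  | inr J => exact B6Prop26PrintedKLevelV1.holder_nonneg i ε J

/-- `‖λ‖ ≥ 0` on both summands. [cite: Balaban1984PropagatorsII, (2.140) p.247, bookkeeping] -/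
theorem l2NormU_nonneg (i : KIdx d ℓ hd hL b₀ b₁) (lam : (kGeoU i).Loc) : 0 ≤ (kGeoU i).l2Norm lam := by
  cases lam with
  | inl f => exact Real.sqrt_nonneg _
  | inr J => exact Real.sqrt_nonneg _

/-- `‖ζ‖_α + |ζ| ≥ 0` on both summands. [cite: Balaban1984PropagatorsII, (2.137) p.247, bookkeeping] -/
theorem cutHU_nonneg (i : KIdx d ℓ hd hL b₀ b₁) (α : ℝ) (ζ : (kGeoU i).Cut) : 0 ≤ (kGeoU i).cutH α ζ := by
  cases ζ with
  | inl z => exact cutH_site_nonneg i α z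
  | inr z => exact cutH_bond_nonneg i α z

/-- `|h| ≥ 0` on both summands. [cite: Balaban1984PropagatorsII, (2.140) p.247, bookkeeping] -/
theorem cutSupU_nonneg (i : KIdx d ℓ hd hL b₀ b₁) (ζ : (kGeoU i).Cut) : 0 ≤ (kGeoU i).cutSup ζ := by
  cases ζ with
  | inl z => exact Real.iSup_nonneg fun _ => abs_nonneg _
  | inr z => exact Real.iSup_nonneg fun _ => abs_nonneg _

/-- **THE KNIT REDUCES PROP. 2.6 TO r03's CENSUS FORM**: the verbatim `B6.Prop26Printed` on the block-site reading `kGeoG`∕`kG` (dag-p1's T1 target, the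
slots of `B6Prop26PrintedKLevelV1.prop26Printed_kLevel_of_slots`) implies it on the tower block's geometry `kGeoU`∕`GU` — blocks → bonds through the
carrier block `β` (same lengths `lenG_beta_eq`, same torus distance), constants `|C(·)|`, zero functionals on the site summands.
[cite: Balaban1984PropagatorsII, Prop. 2.6 (2.136)–(2.141) p.247, p.248 («sites replaced by bonds»)] -/
theorem prop26_tower_of_kGeoG
    (h : B6.Prop26Printed (fun i : KIdx d ℓ hd hL b₀ b₁ => kGeoG i) (fun i => kG i)) :
    B6.Prop26Printed (fun i : KRIdx d ℓ hd hL b₀ b₁ => kGeoU i.1) (fun i => GU i.1) := by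
  obtain ⟨M₁, δ₃, C, Cα, Cε, Cαε, hM₁, hδ₃, hC, hh⟩ := h
  refine ⟨M₁, δ₃, C, fun α => |Cα α|, fun ε => |Cε ε|, fun α ε => |Cαε α ε|, hM₁, hδ₃, hC, fun i _ hM => ?_⟩
  obtain ⟨c1, c2, c3, c4, c5⟩ := hh i.1 trivial hM
  have hlen : ∀ b : (kGeoU i.1).Site, 0 < (kGeoU i.1).len b := fun b => B6KLevelCensusIndexV1.len_pos i.1 b
  refine ⟨?_, ?_, ?_, ?_, ?_⟩
  · intro n lam b b' hsupp
    cases lam with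
    | inr J =>
      have h' := c1 n J (β i.1.hN i.1.D i.1.hk b) (β i.1.hN i.1.D i.1.hk b') hsupp
      rw [lenG_beta_eq] at h'
      exact h'
    | inl f =>
      show (0 : ℝ) ≤ C * B6.pref4 ((kGeoU i.1).len b) n * Real.exp (-(δ₃ * (kGeoU i.1).dist b b')) * (kGeoU i.1).supNorm (Sum.inl f)
      have := B6Prop26PrintedKLevelV1.pref4_nonneg (hlen b).le n
      have := supNormU_nonneg i.1 (Sum.inl f)
      positivity
  · intro α lam ζ b b' hα0 hα1 hζ hsupp
    have hR : 0 ≤ (kGeoU i.1).len b ^ (1 - α) * (kGeoU i.1).cutH α ζ * Real.exp (-(δ₃ * (kGeoU i.1).dist b b')) *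
        (kGeoU i.1).supNorm lam := by
      have := cutHU_nonneg i.1 α ζ
      have := supNormU_nonneg i.1 lam
      have := Real.rpow_pos_of_pos (hlen b) (1 - α)
      positivity
    match lam, ζ, hζ, hsupp, hR with
    | .inr J, .inr z, hζ, hsupp, hR =>
      have h' := c2 α J z (β i.1.hN i.1.D i.1.hk b) (β i.1.hN i.1.D i.1.hk b') hα0 hα1 hζ hsupp
      rw [lenG_beta_eq] at h'
      calc (GU i.1).h1 (Sum.inr J) α (Sum.inr z) = (kG i.1).h1 J α z := rfl
        _ ≤ Cα α * (kGeoU i.1).len b ^ (1 - α) * (kGeoG i.1).cutH α z * Real.exp (-(δ₃ * (kGeoG i.1).dist (β i.1.hN i.1.D i.1.hk b) (β i.1.hN i.1.D i.1.hk b'))) * (kGeoG i.1).supNorm J := h'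
        _ = Cα α * ((kGeoU i.1).len b ^ (1 - α) * (kGeoU i.1).cutH α (Sum.inr z) * Real.exp (-(δ₃ * (kGeoU i.1).dist b b')) * (kGeoU i.1).supNorm (Sum.inr J)) := by ring
        _ ≤ |Cα α| * ((kGeoU i.1).len b ^ (1 - α) * (kGeoU i.1).cutH α (Sum.inr z) * Real.exp (-(δ₃ * (kGeoU i.1).dist b b')) * (kGeoU i.1).supNorm (Sum.inr J)) :=
          mul_le_mul_of_nonneg_right (le_abs_self _) hR
        _ = _ := by ring
    | .inl f, ζ, _, _, hR =>
      show (0 : ℝ) ≤ |Cα α| * (kGeoU i.1).len b ^ (1 - α) * (kGeoU i.1).cutH α ζ * Real.exp (-(δ₃ * (kGeoU i.1).dist b b')) * (kGeoU i.1).supNorm (Sum.inl f)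
      have : 0 ≤ |Cα α| := abs_nonneg _
      nlinarith [mul_nonneg this hR]
    | .inr J, .inl z, _, _, hR =>
      show (0 : ℝ) ≤ |Cα α| * (kGeoU i.1).len b ^ (1 - α) * (kGeoU i.1).cutH α (Sum.inl z) * Real.exp (-(δ₃ * (kGeoU i.1).dist b b')) * (kGeoU i.1).supNorm (Sum.inr J)
      have : 0 ≤ |Cα α| := abs_nonneg _
      nlinarith [mul_nonneg this hR]
  · intro ε lam b b' hε0 hε1 hsupp
    have hR : 0 ≤ Real.exp (-(δ₃ * (kGeoU i.1).dist b b')) * ((kGeoU i.1).holder ε lam + (kGeoU i.1).supNorm lam) := by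
      have := holderU_nonneg i.1 ε lam
      have := supNormU_nonneg i.1 lam
      positivity
    cases lam with
    | inr J =>
      have h' := c3 ε J (β i.1.hN i.1.D i.1.hk b) (β i.1.hN i.1.D i.1.hk b') hε0 hε1 hsupp
      calc (GU i.1).e4 (Sum.inr J) b = (kG i.1).e4 J (β i.1.hN i.1.D i.1.hk b) := rfl
        _ ≤ Cε ε * Real.exp (-(δ₃ * (kGeoG i.1).dist (β i.1.hN i.1.D i.1.hk b) (β i.1.hN i.1.D i.1.hk b'))) * ((kGeoG i.1).holder ε J + (kGeoG i.1).supNorm J) := h'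
        _ = Cε ε * (Real.exp (-(δ₃ * (kGeoU i.1).dist b b')) * ((kGeoU i.1).holder ε (Sum.inr J) + (kGeoU i.1).supNorm (Sum.inr J))) := by ring
        _ ≤ |Cε ε| * (Real.exp (-(δ₃ * (kGeoU i.1).dist b b')) * ((kGeoU i.1).holder ε (Sum.inr J) + (kGeoU i.1).supNorm (Sum.inr J))) :=
          mul_le_mul_of_nonneg_right (le_abs_self _) hR
        _ = _ := by ring
    | inl f =>
      show (0 : ℝ) ≤ |Cε ε| * Real.exp (-(δ₃ * (kGeoU i.1).dist b b')) * ((kGeoU i.1).holder ε (Sum.inl f) + (kGeoU i.1).supNorm (Sum.inl f))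
      have : 0 ≤ |Cε ε| := abs_nonneg _
      nlinarith [mul_nonneg this hR]
  · intro α ε lam ζ b b' hα0 hε0 hαε hζ hsupp
    have hR : 0 ≤ (kGeoU i.1).len b ^ (-α) * (kGeoU i.1).cutH α ζ * Real.exp (-(δ₃ * (kGeoU i.1).dist b b')) *
        ((kGeoU i.1).holder (α + ε) lam + (kGeoU i.1).supNorm lam) := by
      have := cutHU_nonneg i.1 α ζ
      have := holderU_nonneg i.1 (α + ε) lam
      have := supNormU_nonneg i.1 lam
      have := Real.rpow_pos_of_pos (hlen b) (-α)
      positivity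
    match lam, ζ, hζ, hsupp, hR with
    | .inr J, .inr z, hζ, hsupp, hR =>
      have h' := c4 α ε J z (β i.1.hN i.1.D i.1.hk b) (β i.1.hN i.1.D i.1.hk b') hα0 hε0 hαε hζ hsupp
      rw [lenG_beta_eq] at h'
      calc (GU i.1).h2 (Sum.inr J) α (Sum.inr z) = (kG i.1).h2 J α z := rfl
        _ ≤ Cαε α ε * (kGeoU i.1).len b ^ (-α) * (kGeoG i.1).cutH α z * Real.exp (-(δ₃ * (kGeoG i.1).dist (β i.1.hN i.1.D i.1.hk b) (β i.1.hN i.1.D i.1.hk b'))) *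
            ((kGeoG i.1).holder (α + ε) J + (kGeoG i.1).supNorm J) := h'
        _ = Cαε α ε * ((kGeoU i.1).len b ^ (-α) * (kGeoU i.1).cutH α (Sum.inr z) * Real.exp (-(δ₃ * (kGeoU i.1).dist b b')) *
            ((kGeoU i.1).holder (α + ε) (Sum.inr J) + (kGeoU i.1).supNorm (Sum.inr J))) := by ring
        _ ≤ |Cαε α ε| * ((kGeoU i.1).len b ^ (-α) * (kGeoU i.1).cutH α (Sum.inr z) * Real.exp (-(δ₃ * (kGeoU i.1).dist b b')) *
            ((kGeoU i.1).holder (α + ε) (Sum.inr J) + (kGeoU i.1).supNorm (Sum.inr J))) :=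
          mul_le_mul_of_nonneg_right (le_abs_self _) hR
        _ = _ := by ring
    | .inl f, ζ, _, _, hR =>
      show (0 : ℝ) ≤ |Cαε α ε| * (kGeoU i.1).len b ^ (-α) * (kGeoU i.1).cutH α ζ * Real.exp (-(δ₃ * (kGeoU i.1).dist b b')) *
        ((kGeoU i.1).holder (α + ε) (Sum.inl f) + (kGeoU i.1).supNorm (Sum.inl f))
      have : 0 ≤ |Cαε α ε| := abs_nonneg _
      nlinarith [mul_nonneg this hR]
    | .inr J, .inl z, _, _, hR =>
      show (0 : ℝ) ≤ |Cαε α ε| * (kGeoU i.1).len b ^ (-α) * (kGeoU i.1).cutH α (Sum.inl z) * Real.exp (-(δ₃ * (kGeoU i.1).dist b b')) *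
        ((kGeoU i.1).holder (α + ε) (Sum.inr J) + (kGeoU i.1).supNorm (Sum.inr J))
      have : 0 ≤ |Cαε α ε| := abs_nonneg _
      nlinarith [mul_nonneg this hR]
  · intro n lam h b b' hh' hsupp
    have hR : 0 ≤ C * B6.pref6 ((kGeoU i.1).len b) n * (kGeoU i.1).cutSup h * Real.exp (-(δ₃ * (kGeoU i.1).dist b b')) *
        (kGeoU i.1).l2Norm lam := by
      have := B6Prop26PrintedKLevelV1.pref6_nonneg (hlen b).le n
      have := cutSupU_nonneg i.1 h
      have := l2NormU_nonneg i.1 lam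
      positivity
    match lam, h, hh', hsupp, hR with
    | .inr J, .inr z, hh', hsupp, _ =>
      have h' := c5 n J z (β i.1.hN i.1.D i.1.hk b) (β i.1.hN i.1.D i.1.hk b') hh' hsupp
      rw [lenG_beta_eq] at h'
      exact h'
    | .inl f, h, _, _, hR => exact hR
    | .inr J, .inl z, _, _, hR => exact hR

/-! ## §9. THE KNIT: the N03 leaf on the tower block of record from its residual inputs -/

variable (d ℓ hd hL b₀ b₁) in
/-- **`DagBinding.B6BlockParam` ON THE TOWER BLOCK OF RECORD FROM ITS RESIDUAL INPUTS** — Props. 2.3, 2.7 and Cor. 2.8 are discharged BY NAME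
(`prop23_tower`, `prop27_tower`, `cor28_tower`); Prop. 2.6 enters in r03's census form on `kGeoG` (`prop26_tower_of_kGeoG`); what remains displayed is
Lemma 2.1 in parameter form and Prop. 2.2 on the unified geometry, and Lemma 2.4 ∕ Prop. 2.5 on the chosen index-independent carriers.  These displayed
hypotheses ARE the dag-p1 targets on this object (`h21`: dag-p1's `B6Lemma21ParamKLevelTorus.lemma21Param_kLevelTorusP` on `geoTP` along `toKT` —
whence the `R − 1` field of `kGeoU` — plus the fibre count of `β` (index bonds per carrier block) for (2.61); `h26`: the slots of
`B6Prop26PrintedKLevelV1.prop26Printed_kLevel_of_slots`; `h22`: T8's `prop22Printed_kLevelTorusP` along `toKT` for the sup clause, the Hölder clause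
needs the site-vs-bond cut-off comparison; `h24`∕`h25`: the one-level carriers by name once pinned). [cite: Balaban1984PropagatorsII, pp.223–250 (the stated block; Lemma 2.1 p.234, Props. 2.2–2.3 pp.234–238, Lemma 2.4 p.245, Props. 2.5–2.7, Cor. 2.8 pp.246–249)] -/
theorem b6BlockParam_tower_of (hℓ : 1 ≤ ℓ) (hb₀ : 0 < b₀) (hb₁ : b₀ ≤ b₁) (δ₀ : ℝ) {Jt Kt : Type} (tree : Jt → B6.TreeData)
    (loc : Kt → B6.LocalOp)
    (h21 : DagBinding.B6Lemma21Param (towerBlockOfRecord d ℓ hd hL b₀ b₁ δ₀ tree loc))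
    (h22 : B6.Prop22Printed (fun i : KRIdx d ℓ hd hL b₀ b₁ => kGeoU i.1) (fun i => GpU i.1))
    (h24 : B6.Lemma24Printed (d + 1) (((ℓ + 1 : ℕ) : ℝ)) tree) (h25 : B6.Prop25Printed loc)
    (h26 : B6.Prop26Printed (fun i : KIdx d ℓ hd hL b₀ b₁ => kGeoG i) (fun i => kG i)) :
    DagBinding.B6BlockParam (towerBlockOfRecord d ℓ hd hL b₀ b₁ δ₀ tree loc) :=
  ⟨h21, h22, prop23_tower d ℓ hd hL b₀ b₁ hℓ, h24, h25, prop26_tower_of_kGeoG h26, prop27_tower d ℓ hd hL hb₀ hb₁,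
    cor28_tower d ℓ hd hL hb₀ hb₁⟩

end Literature.MathematicalPhysics.QuantumFieldTheory.Balaban1983to89.Node00

end
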